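import Summits.CriticalPhenomena.PercolationContinuityZ3.Theorems.Transplant.SkelPhiFaceResidue
import Summits.CriticalPhenomena.PercolationContinuityZ3.Theorems.Transplant.KNLevelsKitsForced
import Summits.CriticalPhenomena.PercolationContinuityZ3.Theorems.Transplant.KNCells2Face
import HarnessLib

/-!
# N2 (frames-only node), (S0) kit tier, WAVE 0 (c2) residue layer — the (F) part (hp-8 g39): **THE φ-LEVEL FACE RESIDUE OVER (S0)-SHAPE KITS**
# `Skelφ.FaceOblAtF` / `FaceOblAtMF` and **`cond_j` FROM IT** (`cond_of_faceOblAtF` / `cond_of_faceOblAtMF`) — the F-twins of hp-8 g30's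
# `SkelPhiFaceResidue` §1–§2 (`Skelφ.FaceOblAt`, `cond_of_faceOblAt`), of `SkelPhiWinStep`'s `kitsAt_tstep` / `cond_of_winStep`, and of
# `KNCells.KSchA.cond_of_step` (KNCells2Face), with p1-g16's bundle `TStep.KitsAtF` (KNLevelsKitsForced) in place of `TStep.KitsAt`
# (C2-SPEC §2 FACE, design owner p3-g15 2026-08-22 20:05Z; the run-restricted ORIENTED wrapper `Skelφ.FaceOblRMOF` over `FaceOblAtMF` and the packaging
# to `KSchA.KitAtRunO` are p3-g15's `SkelKitResiduesOF`, behind stmt-g19's `KNCells2RunRestrictedO`)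

builds on p205010 (kernel theorem, internal audit signed; external expert review pending) — nothing in this file uses p205010; nothing here is a
claim about the open node `SamePDropOfSkeletonFrm₁`.
Lane `prim-bschramm`, seat `prim-hp-8` (gen 39); helper file (`--supports stmt-CriticalPhenomena-4575 --as helper`).
Port rule ((S0), (R-13)/(R-16), p1-g16 2026-08-22 19:19:25Z): in the per-level kit rows of `FaceOblAt` the three N1 clauses `Sz ⊆ X j'`, 'seeds off
`E(Sz)`', 'Step-IV face estimate' are replaced by the RELAY CLAUSE (`KNLevels.RelayClause … δ₂`), i.e. the rows become `kitsAt_stepAFF`'s /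
`kitClause_frameF`'s output conjunction verbatim; the generic one-step property `hstep` is quantified over steps with `KitsAtF`; everything else
(window step, subbox/support facts, count, true target, rim excess `≤ η ≤ δc/2`, `F^{j+1} ⊆ X₀`) is N1's text.  No oriented name occurs here: the
arguments `(h, e, a, a', du, j, o)` are free, so the file sits BELOW the oriented macro layer and can land now.
* §1 `KNCells.KSchA.cond_of_stepF` — (I2) from one target step with an enlarged target, `KitsAtF` form;
* §2 `Skelφ.kitsAt_tstepF` (`KitsAtF` of the φ-level window step `tstep` from F-shape per-level rows), `Skelφ.cond_of_winStepF`;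
* §3 **`Skelφ.FaceOblAtF`**, **`Skelφ.FaceOblAtMF`** (map per face: `∃ ψ', Lip G ψ' ∧ FaceOblAtF G ψ' …`), **`Skelφ.cond_of_faceOblAtF`**,
  **`Skelφ.cond_of_faceOblAtMF`**, `Skelφ.FaceOblAt.toF` (an N1 face residue is an (S0) one, by `relayClause_of_stepIV`, `δ₂ ≥ 0`).
[cite: KozmaNitzan2024, §4 p. 30 (Step III, (30)), Lemma 10 (pp. 17–22), Lemma 11 (p. 22)] [this work]
-/

noncomputable section

open MeasureTheory ProbabilityTheory
open scoped ENNReal Classical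

namespace Summit.CriticalPhenomena.PercolationContinuityZ3.Theorems

namespace Transplant

/-! ## §1 (I2) from one target step, (S0)-shape kits -/

namespace KNCells

namespace KSchA

open Literature.Probability.Percolation Literature.Probability.LatticeModels SimpleGraph GadgetSystem ProbeHistory HSiteScheme Contour

variable {V : Type*} [DecidableEq V]
variable {A : Type*} {G : SimpleGraph V} [G.LocallyFinite] {S : KSchA V A} {FD : FaceData V A}
variable {h : ProbeHistory V} {e : Site 2 × MDir} {a a' : A} {du : MDir} {j : ℕ} {o : Finset (Sym2 V)}

/-- **(I2) FROM ONE TARGET STEP WITH AN ENLARGED TARGET, (S0)-SHAPE KITS**: the one-step property of `G'` quantified over steps with `KitsAtF` at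
`(δ₂ ↦ δc/2)`, a step `s` sourced at the root with `KitsAtF` under the face law `Wt`, a true target `T' ⊆ M^{a'}_{x+du}` inside `s.T` with rim excess
`≤ η ≤ δc/2`, the face `F^{j+1}` inside the first level and the source bound ⟹ `cond` ((30)). Proof verbatim from `cond_of_step`.
[cite: KozmaNitzan2024, §4 p. 30 (Step III), Lemma 10 (p. 17)] [this work] -/
theorem cond_of_stepF (G' : SimpleGraph V) [G'.LocallyFinite] {Δ' : ℕ} {δ₂ η : ℝ}
    (hstep : ∀ (W : Sym2 V → unitInterval) (s : KNLevels.TStep G'), s.KitsAtF W S.p Δ' δ₂ →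
      1 - δ₂ < (prodBernoulli W).real s.L.reachB → 1 - S.δc / 2 < (prodBernoulli W).real (⋃ t ∈ s.T, openConn s.L.o t))
    (s : KNLevels.TStep G') (ho : s.L.o = S.Γ.root) (hkits : s.KitsAtF (S.Wt G h e a a' du j o) S.p Δ' δ₂)
    (T' : Finset V) (hT' : T' ⊆ s.T) (hT'M : T' ⊆ S.Γ.M a' (tgt e + stepVec du))
    (hexc : (prodBernoulli (S.Wt G h e a a' du j o)).real (⋃ t ∈ s.T \ T', openConn S.Γ.root t) ≤ η) (hη : η ≤ S.δc / 2)
    (hface : FD.Face a' (tgt e) du (j + 1) ⊆ s.L.X 0)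
    (hsrc : 1 - δ₂ < (prodBernoulli (S.Wt G h e a a' du j o)).real (⋃ b ∈ FD.Face a' (tgt e) du (j + 1), openConn S.Γ.root b)) :
    S.cond G h e a a' du j o := by
  set W := S.Wt G h e a a' du j o with hW
  -- the source: the face lies in the first level
  have hreachB : 1 - δ₂ < (prodBernoulli W).real s.L.reachB := by
    refine hsrc.trans_le (measureReal_mono ?_ (measure_ne_top _ _))
    intro ω hω
    simp only [Set.mem_iUnion, exists_prop] at hω
    obtain ⟨b, hb, hωb⟩ := hω
    rw [KNLevels.LData.reachB, ho]
    exact Set.mem_biUnion (Finset.mem_coe.2 (hface hb)) hωb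
  have h1 := hstep W s hkits hreachB
  rw [ho] at h1
  have h2 := KNLevels.real_biUnion_openConn_le_add_sdiff (prodBernoulli W) S.Γ.root hT'
  have h3 : (prodBernoulli W).real (⋃ t ∈ T', openConn S.Γ.root t) ≤ (prodBernoulli W).real (S.Conn a' e du) := by
    refine measureReal_mono ?_ (measure_ne_top _ _)
    intro ω hω
    simp only [Set.mem_iUnion, exists_prop] at hω
    obtain ⟨t, ht, hωt⟩ := hω
    rw [Conn]
    exact Set.mem_biUnion (Finset.mem_coe.2 (hT'M ht)) hωt
  rw [cond]
  linarith

end KSchA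

end KNCells

/-! ## §2 The φ-level window step over (S0)-shape kits -/

namespace Skelφ

open Literature.Probability.Percolation Literature.Probability.LatticeModels SimpleGraph KNCells
open Literature.Probability.Percolation.KozmaNitzan
open KNLevels
open Skel (winGraph winGraphIn WinStepData)
open GadgetSystem ProbeHistory HSiteScheme Contour

variable {V : Type} [DecidableEq V] {G : SimpleGraph V} [G.LocallyFinite] {φ : V → Site 2}

/-- **`KitsAtF` of the φ-level window step** (from `Lip`): a subbox region in the window graph, finite support, the source off the region, the
planar enclosure, `T ⊆ D` nonempty, the count inequality and the per-level FORCED-kit rows (`SHyp ∧ σ.N ≤ P.N ∧ (1 − p^{sB})^k ≤ δ ∧ Sz ⊆ D ∧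
faces ⊆ Sz ∧ RelayClause`). [cite: KozmaNitzan2024, §4 Lemma 10 (p. 17)] [this work] -/
theorem kitsAt_tstepF (hlip : Lip G φ) {P : WinStepData V} {Wt : Sym2 V → unitInterval}
    {p : unitInterval} {Δ : ℕ} {δ : ℝ}
    (hsub : IsSubbox (winGraph G P.root P.Rπ) Wt p (stepRg G φ P)) (hfin : FinSupp Wt P.Sfin) (hDS : stepRg G φ P ⊆ P.Sfin)
    (hencl : Finset.Icc (P.lo - ((P.Rlev + 1 : ℕ) : Site 2)) (P.hi + ((P.Rlev + 1 : ℕ) : Site 2)) ⊆ P.Dpl)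
    (ho : P.root ∉ stepRg G φ P) (hoS : P.root ∈ P.Sfin) (hj : P.j₁ ≤ P.Rlev) (hTD : P.T ⊆ stepRg G φ P) (hTne : P.T.Nonempty)
    (hcount : 1 / (1 - (p : ℝ)) ^ (Δ * P.N) ≤ δ * ((Finset.Icc P.j₀ P.j₁).card : ℝ))
    (hkits : ∀ j ∈ Finset.Icc P.j₀ P.j₁, ∃ (σ : SData V) (S : Finset V),
      SHyp (winLData G φ P.root P.Rπ P.lo P.hi P.root P.Sfin) j σ ∧ σ.N ≤ P.N ∧
      (1 - (p : ℝ) ^ σ.sB) ^ σ.k ≤ δ ∧ S ⊆ stepRg G φ P ∧ (∀ x ∈ σ.K, σ.face x ⊆ S) ∧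
      RelayClause (winLData G φ P.root P.Rπ P.lo P.hi P.root P.Sfin) Wt j σ S P.T (stepRg G φ P) δ) :
    (tstep G φ P).KitsAtF Wt p Δ δ :=
  ⟨lhyp_win hlip P.root P.Rπ P.lo P.hi hsub hfin hDS (stepLv_encl_of_planar G φ hencl) ho hoS, hj, hTD, hTne, hcount, hkits⟩

/-- **`cond_j` FROM ONE WINDOW STEP, (S0)-SHAPE KITS** (from `Lip`): one window step `P` rooted at the scheme's root whose first level contains
the face `F^{j+1}`, with the subbox / support facts of the law `Wt`, Step II's count at accuracy `δ₂`, the per-level FORCED-kit rows at accuracy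
`δ₂`, a true target `T' ⊆ M^{a'}_{x+du}` inside the enlarged target with rim excess `≤ η ≤ δc/2`, the generic one-step property of the window graph
(over `KitsAtF` steps) and the source bound `1 - δ₂ < P_{Wt}(root ↔ F^{j+1})` gives `cond` (F-twin of `cond_of_winStep`).
[cite: KozmaNitzan2024, §4 p. 30 (Step III), Lemma 10 (p. 17)] [this work] -/
theorem cond_of_winStepF [Countable V] (hlip : Lip G φ) {A : Type*} {S : KSchA V A} {FD : FaceData V A}
    {h : ProbeHistory V} {e : Site 2 × MDir} {a a' : A} {du : MDir} (P : WinStepData V) {j : ℕ} {o : Finset (Sym2 V)} {Δ' : ℕ}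
    {δ₂ η : ℝ}
    (hstep : ∀ (Wg : Sym2 V → unitInterval) (s : TStep (winGraph G P.root P.Rπ)), s.KitsAtF Wg S.p Δ' δ₂ →
      1 - δ₂ < (prodBernoulli Wg).real s.L.reachB → 1 - S.δc / 2 < (prodBernoulli Wg).real (⋃ t ∈ s.T, openConn s.L.o t))
    (hroot : P.root = S.Γ.root)
    (hsub : IsSubbox (winGraph G P.root P.Rπ) (S.Wt G h e a a' du j o) S.p (stepRg G φ P))
    (hfin : FinSupp (S.Wt G h e a a' du j o) P.Sfin) (hDS : stepRg G φ P ⊆ P.Sfin)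
    (hencl : Finset.Icc (P.lo - ((P.Rlev + 1 : ℕ) : Site 2)) (P.hi + ((P.Rlev + 1 : ℕ) : Site 2)) ⊆ P.Dpl)
    (ho : P.root ∉ stepRg G φ P) (hoS : P.root ∈ P.Sfin) (hj : P.j₁ ≤ P.Rlev) (hTD : P.T ⊆ stepRg G φ P) (hTne : P.T.Nonempty)
    (hcount : 1 / (1 - (S.p : ℝ)) ^ (Δ' * P.N) ≤ δ₂ * ((Finset.Icc P.j₀ P.j₁).card : ℝ))
    (hkits : ∀ j' ∈ Finset.Icc P.j₀ P.j₁, ∃ (σ : SData V) (Sz : Finset V),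
      SHyp (winLData G φ P.root P.Rπ P.lo P.hi P.root P.Sfin) j' σ ∧ σ.N ≤ P.N ∧
      (1 - (S.p : ℝ) ^ σ.sB) ^ σ.k ≤ δ₂ ∧ Sz ⊆ stepRg G φ P ∧ (∀ x ∈ σ.K, σ.face x ⊆ Sz) ∧
      RelayClause (winLData G φ P.root P.Rπ P.lo P.hi P.root P.Sfin) (S.Wt G h e a a' du j o) j' σ Sz P.T (stepRg G φ P) δ₂)
    (T' : Finset V) (hT' : T' ⊆ P.T) (hT'M : T' ⊆ S.Γ.M a' (tgt e + stepVec du))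
    (hexc : (prodBernoulli (S.Wt G h e a a' du j o)).real (⋃ t ∈ P.T \ T', openConn S.Γ.root t) ≤ η) (hη : η ≤ S.δc / 2)
    (hface : FD.Face a' (tgt e) du (j + 1) ⊆ (stepLv G φ P).X 0)
    (hsrc : 1 - δ₂ < (prodBernoulli (S.Wt G h e a a' du j o)).real
      (⋃ b ∈ FD.Face a' (tgt e) du (j + 1), openConn S.Γ.root b)) :
    S.cond G h e a a' du j o :=
  KSchA.cond_of_stepF (winGraph G P.root P.Rπ) hstep (tstep G φ P) (by rw [tstep_o, hroot])
    (kitsAt_tstepF hlip hsub hfin hDS hencl ho hoS hj hTD hTne hcount hkits) T' hT' hT'M hexc hη hface hsrc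

/-! ## §3 The φ-level face residue over (S0)-shape kits -/

variable [Countable V] (G) (φ)
variable {A : Type*}

/-- **The face obligation at one face, (S0)-shape kits** `(h, e, a, a', du, j, o)` for the planar map `φ`: a window step `P` rooted (and centred) at
the scheme's root whose first level contains `F^{j+1}`, with the subbox / support facts of the law `Wt`, Step II's count at accuracy `δ₂`, the
per-level FORCED-kit rows at accuracy `δ₂` (Step-III seed data with the seed bound, a shell `Sz ⊆ D` containing the faces, and the RELAY CLAUSE — in
place of N1's `Sz ⊆ X j'` / seeds-off-`E(Sz)` / Step-IV face estimate), a true target `T' ⊆ M^{a'}_{x+du}` inside the enlarged target and the rim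
excess `≤ η ≤ δc/2` — the hypotheses of `Skelφ.cond_of_winStepF` except the generic one-step property and the source bound (F-twin of
`Skelφ.FaceOblAt`). [cite: KozmaNitzan2024, §4 p. 30 (Step III), Lemma 10 (pp. 17–22)] [this work] -/
def FaceOblAtF (S : KSchA V A) (FD : FaceData V A) (Δ' : ℕ) (δ₂ : ℝ) (h : ProbeHistory V) (e : Site 2 × MDir) (a a' : A) (du : MDir)
    (j : ℕ) (o : Finset (Sym2 V)) : Prop :=
  ∃ (P : WinStepData V) (T' : Finset V) (η : ℝ),
    P.root = S.Γ.root ∧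
    KNLevels.IsSubbox (winGraph G P.root P.Rπ) (S.Wt G h e a a' du j o) S.p (stepRg G φ P) ∧
    KNLevels.FinSupp (S.Wt G h e a a' du j o) P.Sfin ∧ stepRg G φ P ⊆ P.Sfin ∧
    Finset.Icc (P.lo - ((P.Rlev + 1 : ℕ) : Site 2)) (P.hi + ((P.Rlev + 1 : ℕ) : Site 2)) ⊆ P.Dpl ∧
    P.root ∉ stepRg G φ P ∧ P.root ∈ P.Sfin ∧ P.j₁ ≤ P.Rlev ∧ P.T ⊆ stepRg G φ P ∧ P.T.Nonempty ∧
    1 / (1 - (S.p : ℝ)) ^ (Δ' * P.N) ≤ δ₂ * ((Finset.Icc P.j₀ P.j₁).card : ℝ) ∧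
    (∀ j' ∈ Finset.Icc P.j₀ P.j₁, ∃ (σ : KNLevels.SData V) (Sz : Finset V),
      KNLevels.SHyp (winLData G φ P.root P.Rπ P.lo P.hi P.root P.Sfin) j' σ ∧ σ.N ≤ P.N ∧
      (1 - (S.p : ℝ) ^ σ.sB) ^ σ.k ≤ δ₂ ∧ Sz ⊆ stepRg G φ P ∧ (∀ x ∈ σ.K, σ.face x ⊆ Sz) ∧
      KNLevels.RelayClause (winLData G φ P.root P.Rπ P.lo P.hi P.root P.Sfin) (S.Wt G h e a a' du j o) j' σ Sz P.T (stepRg G φ P) δ₂) ∧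
    T' ⊆ P.T ∧ T' ⊆ S.Γ.M a' (tgt e + stepVec du) ∧
    (prodBernoulli (S.Wt G h e a a' du j o)).real (⋃ t ∈ P.T \ T', openConn S.Γ.root t) ≤ η ∧ η ≤ S.δc / 2 ∧
    FD.Face a' (tgt e) du (j + 1) ⊆ (stepLv G φ P).X 0

variable {φ}

/-- **The face obligation at one face step with ITS OWN window map, (S0)-shape kits** (`u`-faces and `v`-faces read different frames): some `Lip`
map `ψ'` with `FaceOblAtF G ψ' …` (F-twin of `Skelφ.FaceOblAtM`). [cite: KozmaNitzan2024, §4 p. 30 (Step III)] [this work] -/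
def FaceOblAtMF (S : KSchA V A) (FD : FaceData V A) (Δ' : ℕ) (δ₂ : ℝ) (h : ProbeHistory V) (e : Site 2 × MDir) (a a' : A) (du : MDir)
    (j : ℕ) (o : Finset (Sym2 V)) : Prop :=
  ∃ ψ' : V → Site 2, Lip G ψ' ∧ FaceOblAtF G ψ' S FD Δ' δ₂ h e a a' du j o

variable {G}
variable {S : KSchA V A} {FD : FaceData V A}
variable {h : ProbeHistory V} {e : Site 2 × MDir} {a a' : A} {du : MDir}

/-- **`FaceOblAtF` + the one-step property at `(δ₂ ↦ δc/2)` over `KitsAtF` steps of every window graph + the source bound ⟹ `cond`**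
(`Skelφ.cond_of_winStepF`, from `Lip`). [cite: KozmaNitzan2024, §4 p. 30 (Step III), Lemma 10 (p. 17)] [this work] -/
theorem cond_of_faceOblAtF (hlip : Lip G φ) {Δ' : ℕ} {δ₂ : ℝ} {j : ℕ} {o : Finset (Sym2 V)}
    (hstep : ∀ (c : V) (Rπ : ℕ) (Wg : Sym2 V → unitInterval) (s : KNLevels.TStep (winGraph G c Rπ)), s.KitsAtF Wg S.p Δ' δ₂ →
      1 - δ₂ < (prodBernoulli Wg).real s.L.reachB → 1 - S.δc / 2 < (prodBernoulli Wg).real (⋃ t ∈ s.T, openConn s.L.o t))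
    (hF : FaceOblAtF G φ S FD Δ' δ₂ h e a a' du j o)
    (hsrc : 1 - δ₂ < (prodBernoulli (S.Wt G h e a a' du j o)).real (⋃ b ∈ FD.Face a' (tgt e) du (j + 1), openConn S.Γ.root b)) :
    S.cond G h e a a' du j o := by
  obtain ⟨P, T', η, hroot, hsub, hfin, hDS, hencl, ho, hoS, hj, hTD, hTne, hcount, hkits, hT', hT'M, hexc, hη, hface⟩ := hF
  exact cond_of_winStepF hlip P (hstep P.root P.Rπ) hroot hsub hfin hDS hencl ho hoS hj hTD hTne hcount hkits T' hT' hT'M hexc hη hface hsrc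

/-- **`FaceOblAtMF` + the one-step property over `KitsAtF` steps + the source bound ⟹ `cond`** (the `Lip` of the face's own map feeds
`cond_of_faceOblAtF`; the shape p3-g15's packaging `kitAtRunO_of_oblRHNMWF_src` consumes per run history).
[cite: KozmaNitzan2024, §4 p. 30 (Step III), Lemma 10 (p. 17)] [this work] -/
theorem cond_of_faceOblAtMF {Δ' : ℕ} {δ₂ : ℝ} {j : ℕ} {o : Finset (Sym2 V)}
    (hstep : ∀ (c : V) (Rπ : ℕ) (Wg : Sym2 V → unitInterval) (s : KNLevels.TStep (winGraph G c Rπ)), s.KitsAtF Wg S.p Δ' δ₂ →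
      1 - δ₂ < (prodBernoulli Wg).real s.L.reachB → 1 - S.δc / 2 < (prodBernoulli Wg).real (⋃ t ∈ s.T, openConn s.L.o t))
    (hF : FaceOblAtMF G S FD Δ' δ₂ h e a a' du j o)
    (hsrc : 1 - δ₂ < (prodBernoulli (S.Wt G h e a a' du j o)).real (⋃ b ∈ FD.Face a' (tgt e) du (j + 1), openConn S.Γ.root b)) :
    S.cond G h e a a' du j o := by
  obtain ⟨ψ', hlipψ', hF'⟩ := hF
  exact cond_of_faceOblAtF hlipψ' hstep hF' hsrc

omit [Countable V] in
/-- **An N1 face obligation is an (S0) face obligation** (`δ₂ ≥ 0`): the N1 per-level rows give the relay clause by p1-g16's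
`relayClause_of_stepIV` (Claim D's independence half). [this work] -/
theorem FaceOblAt.toF {Δ' : ℕ} {δ₂ : ℝ} {j : ℕ} {o : Finset (Sym2 V)} (hδ : 0 ≤ δ₂)
    (hF : FaceOblAt G φ S FD Δ' δ₂ h e a a' du j o) : FaceOblAtF G φ S FD Δ' δ₂ h e a a' du j o := by
  obtain ⟨P, T', η, hroot, hsub, hfin, hDS, hencl, ho, hoS, hj, hTD, hTne, hcount, hkits, hT', hT'M, hexc, hη, hface⟩ := hF
  refine ⟨P, T', η, hroot, hsub, hfin, hDS, hencl, ho, hoS, hj, hTD, hTne, hcount, fun j' hj' => ?_, hT', hT'M, hexc, hη, hface⟩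
  obtain ⟨σ, Sz, hσ, hN, hIII, hSX, hSD, hSseed, hUS, hIV⟩ := hkits j' hj'
  exact ⟨σ, Sz, hσ, hN, hIII, hSD, hUS, relayClause_of_stepIV hδ hSX hSseed hIV⟩

end Skelφ

end Transplant

end Summit.CriticalPhenomena.PercolationContinuityZ3.Theorems

end
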